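import Summits.BirchSwinnertonDyer.BirchSwinnertonDyer.Theorems.GenusKolyvaginAtTwoLeafCensusWallU2RankOneResidual
import Summits.BirchSwinnertonDyer.BirchSwinnertonDyer.Theorems.GenusKolyvaginAtTwoMinimalTwinBSDTwoAnalyticTwinNoTwoTorsion
import Summits.BirchSwinnertonDyer.BirchSwinnertonDyer.Theorems.GenusKolyvaginAtTwoMinimalTwinBSDTwoAnalyticTwinNoTwoTorsionCensus
import HarnessLib

/-!
# Route `GenusKolyvaginAtTwo` — TURNKEY CENSUS for the director's deferred design option «U₂′ / R″ = torsion cell» (LEAD bsd-line-gk2-p1 g31)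

Seat `bsd-line-gk2-p1` g31 (LEAD lineage).  THEOREMS ONLY, standard axioms, no `sorry`.  **BSD is NOT proved; the leaf, the WALL rows, U₂, R′, U₂′, R″
and KEX⁰ stay OPEN; nothing is closed; this is NOT a registry proposal** (director-bsd 23:55:10Z: «design option U₂′/R″ LATER — noted, not tonight»).

After rev 67 the route's `closes` binds, BY NAME, the GK2-local WALL copies `Wall{GoodOrdinary,Multiplicative,Supersingular,Additive}RankZeroAtTwo`
(items 19095–19098 attached; renamed by (708)), U₂ `MinimalTwinBSDTwo` (22985) and R′ `RankOneNonMinimalResidualAtTwo` (27107).  This file certifies,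
in the kernel and BY THOSE NAMES:
* §1 the GK2-local WALL copies are the `ByReductionTypeAtTwo` rows VERBATIM (`Iff.rfl` ×4) — so every census theorem stated against
  `Theses.ByReductionTypeAtTwo.*RankZeroAtTwo` (p783309, p794320, p794772, …) transfers to the route's binders by `Iff.rfl`;
* §2 ★ `nonCMAtTwo_iff_wallGK2_and_rankOneNoTwoTorsion_and_torsionCell`: **NonCMAtTwo ⟺ WALL(GK2)×4 ∧ U₂′ ∧ R″** with
  U₂′ := «non-CM, `r_an = 1`, `W(ℚ)[2] = 0` ⟹ BSD₂» and R″ := «non-CM, `r_an = 1`, `W(ℚ)[2] ≠ 0` ⟹ BSD₂» (the TORSION cell) — lossless, and the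
  `closes`-shaped term `nonCMAtTwo_of_wallGK2_of_rankOneNoTwoTorsion_of_torsionCell` (six binders, each load-bearing: one cell each);
* §3 `minimalTwin_and_residual_iff_noTwoTorsion_and_torsionCell`: (U₂ ∧ R′) ⟺ (U₂′ ∧ R″) — the re-cut trades nothing; and, from the landed engine
  p796542, U₂′ ⟸ WALL row 1 + Friedberg–Hoffstein + KEX⁰ + PRINT (`NoTwoTorsion.bsdp_of_wall_of_friedbergHoffstein_of_kex0_of_facts`), so under the
  re-cut the declared residual would shrink from «`#Sel₂(W) ≠ 2`» to «`W(ℚ)[2] ≠ 0`» while the research binder becomes KEX⁰ (harder than KEX′: curves with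
  `Ш(W)[2] ≠ 0` enter).  Census only.

References: [Miller2011LMS] Def. 1.1; [SilvermanAEC2009] X.4.2.
-/

set_option autoImplicit false
set_option linter.dupNamespace false -- `Summit.<P>.<Sub>` repeats `BirchSwinnertonDyer` (D-0017)

noncomputable section

open scoped Classical

namespace Summit.BirchSwinnertonDyer.BirchSwinnertonDyer.Theorems.GenusExact.Census.TorsionCell

open WeierstrassCurve Literature.NumberTheory.EllipticCurves
  Summit.BirchSwinnertonDyer.BirchSwinnertonDyer.Rank1Residual
open Summit.BirchSwinnertonDyer.BirchSwinnertonDyer.Theses.GenusKolyvaginAtTwo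
  (WallGoodOrdinaryRankZeroAtTwo WallMultiplicativeRankZeroAtTwo WallSupersingularRankZeroAtTwo WallAdditiveRankZeroAtTwo
   MinimalTwinBSDTwo RankOneNonMinimalResidualAtTwo)
open Summit.BirchSwinnertonDyer.BirchSwinnertonDyer.Theses.ByReductionTypeAtTwo
  (GoodOrdinaryRankZeroAtTwo MultiplicativeRankZeroAtTwo SupersingularRankZeroAtTwo AdditiveRankZeroAtTwo)
open Summit.BirchSwinnertonDyer.BirchSwinnertonDyer.Theorems.GenusExact.TwinSwap.AnalyticTwin.NoTwoTorsion
  (bsdp_of_wall_of_friedbergHoffstein_of_kex0_of_facts)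
open Summit.BirchSwinnertonDyer.BirchSwinnertonDyer.Theorems.GenusExact.TwinSwap.AnalyticTwin.NoTwoTorsion.Census
  (rankOneBSDTwo_iff_minimalTwin_and_residual)

/-! ## §1 The route's WALL binders are the `ByReductionTypeAtTwo` rows verbatim -/

/-- `WallGoodOrdinaryRankZeroAtTwo` (GK2-local copy, rev 67) ⟺ `ByReductionTypeAtTwo.GoodOrdinaryRankZeroAtTwo` — same text. [cite: Miller2011LMS, Def. 1.1] -/
theorem wallGoodOrdinary_iff : WallGoodOrdinaryRankZeroAtTwo ↔ GoodOrdinaryRankZeroAtTwo := Iff.rfl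

/-- `WallMultiplicativeRankZeroAtTwo` ⟺ `ByReductionTypeAtTwo.MultiplicativeRankZeroAtTwo` — same text. [cite: Miller2011LMS, Def. 1.1] -/
theorem wallMultiplicative_iff : WallMultiplicativeRankZeroAtTwo ↔ MultiplicativeRankZeroAtTwo := Iff.rfl

/-- `WallSupersingularRankZeroAtTwo` ⟺ `ByReductionTypeAtTwo.SupersingularRankZeroAtTwo` — same text. [cite: Miller2011LMS, Def. 1.1] -/
theorem wallSupersingular_iff : WallSupersingularRankZeroAtTwo ↔ SupersingularRankZeroAtTwo := Iff.rfl

/-- `WallAdditiveRankZeroAtTwo` ⟺ `ByReductionTypeAtTwo.AdditiveRankZeroAtTwo` — same text. [cite: Miller2011LMS, Def. 1.1] -/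
theorem wallAdditive_iff : WallAdditiveRankZeroAtTwo ↔ AdditiveRankZeroAtTwo := Iff.rfl

/-- The four GK2-local WALL binders ⟺ the four `ByReductionTypeAtTwo` rows. [cite: Miller2011LMS, Def. 1.1] -/
theorem wallGK2_iff_wallRows :
    (WallGoodOrdinaryRankZeroAtTwo ∧ WallMultiplicativeRankZeroAtTwo ∧ WallSupersingularRankZeroAtTwo ∧ WallAdditiveRankZeroAtTwo) ↔
      (GoodOrdinaryRankZeroAtTwo ∧ MultiplicativeRankZeroAtTwo ∧ SupersingularRankZeroAtTwo ∧ AdditiveRankZeroAtTwo) := Iff.rfl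

/-- **BSD₂ for every non-CM curve of analytic rank `0` from the route's four WALL binders** (tetrachotomy of the reduction type at `2`; = p783309's
`bsdp_rankZero_of_wallRows` read through §1). [cite: Miller2011LMS, Def. 1.1] -/
theorem bsdp_rankZero_of_wallGK2 (hOrd : WallGoodOrdinaryRankZeroAtTwo) (hMult : WallMultiplicativeRankZeroAtTwo)
    (hSS : WallSupersingularRankZeroAtTwo) (hAdd : WallAdditiveRankZeroAtTwo)
    (W : WeierstrassCurve ℚ) [W.IsElliptic] [W.IsGloballyMinimal] (hcm : ¬ W.HasCM) (hr0 : W.analyticRank = 0) : BSDp W 2 :=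
  bsdp_rankZero_of_wallRows hOrd hMult hSS hAdd W hcm hr0

/-! ## §2 The re-cut: NonCMAtTwo ⟺ WALL(GK2)×4 ∧ U₂′ ∧ R″ (torsion cell) -/

/-- **`closes`-shaped term for the deferred re-cut**: the four GK2 WALL binders, U₂′ := «non-CM, `r_an = 1`, `W(ℚ)[2] = 0` ⟹ BSD₂» and the TORSION
cell R″ := «non-CM, `r_an = 1`, `W(ℚ)[2] ≠ 0` ⟹ BSD₂» give the leaf.  Each binder closes exactly one cell (rank `0` × four reduction types at `2`;
rank `1` without / with rational `2`-torsion) — none idle.  CONDITIONAL (all six are hypotheses); proves nothing about BSD; closes nothing.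
[cite: Miller2011LMS, Def. 1.1] -/
theorem nonCMAtTwo_of_wallGK2_of_rankOneNoTwoTorsion_of_torsionCell (hOrd : WallGoodOrdinaryRankZeroAtTwo)
    (hMult : WallMultiplicativeRankZeroAtTwo) (hSS : WallSupersingularRankZeroAtTwo) (hAdd : WallAdditiveRankZeroAtTwo)
    (hU : ∀ (W : WeierstrassCurve ℚ) [W.IsElliptic] [W.IsGloballyMinimal],
      ¬ W.HasCM → W.analyticRank = 1 → (∀ P : W.toAffine.Point, 2 • P = 0 → P = 0) → BSDp W 2)
    (hT : ∀ (W : WeierstrassCurve ℚ) [W.IsElliptic] [W.IsGloballyMinimal],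
      ¬ W.HasCM → W.analyticRank = 1 → (¬ ∀ P : W.toAffine.Point, 2 • P = 0 → P = 0) → BSDp W 2) :
    NonCMAtTwo := by
  intro W _ _ hcm hr
  rcases Nat.lt_or_ge W.analyticRank 1 with h0 | h1
  · exact bsdp_rankZero_of_wallGK2 hOrd hMult hSS hAdd W hcm (Nat.lt_one_iff.mp h0)
  · have hr1 : W.analyticRank = 1 := le_antisymm hr h1
    by_cases htor : ∀ P : W.toAffine.Point, 2 • P = 0 → P = 0
    · exact hU W hcm hr1 htor
    · exact hT W hcm hr1 htor

/-- ★ **NonCMAtTwo ⟺ WALL(GK2)×4 ∧ U₂′ ∧ R″ — LOSSLESS** (the leaf gives back each binder: the WALL rows at rank `0`, and both rank-one cells).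
Census only; BSD is NOT proved. [cite: Miller2011LMS, Def. 1.1] -/
theorem nonCMAtTwo_iff_wallGK2_and_rankOneNoTwoTorsion_and_torsionCell :
    NonCMAtTwo ↔
      (WallGoodOrdinaryRankZeroAtTwo ∧ WallMultiplicativeRankZeroAtTwo ∧ WallSupersingularRankZeroAtTwo ∧ WallAdditiveRankZeroAtTwo) ∧
      (∀ (W : WeierstrassCurve ℚ) [W.IsElliptic] [W.IsGloballyMinimal],
        ¬ W.HasCM → W.analyticRank = 1 → (∀ P : W.toAffine.Point, 2 • P = 0 → P = 0) → BSDp W 2) ∧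
      (∀ (W : WeierstrassCurve ℚ) [W.IsElliptic] [W.IsGloballyMinimal],
        ¬ W.HasCM → W.analyticRank = 1 → (¬ ∀ P : W.toAffine.Point, 2 • P = 0 → P = 0) → BSDp W 2) := by
  constructor
  · intro hleaf
    refine ⟨wallGK2_iff_wallRows.mpr (wallRows_of_nonCMAtTwo hleaf), ?_, ?_⟩
    · exact fun W _ _ hcm hr _ ↦ hleaf W hcm (by rw [hr])
    · exact fun W _ _ hcm hr _ ↦ hleaf W hcm (by rw [hr])
  · rintro ⟨⟨hOrd, hMult, hSS, hAdd⟩, hU, hT⟩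
    exact nonCMAtTwo_of_wallGK2_of_rankOneNoTwoTorsion_of_torsionCell hOrd hMult hSS hAdd hU hT

/-! ## §3 The re-cut trades nothing: (U₂ ∧ R′) ⟺ (U₂′ ∧ R″); and U₂′ is the conclusion of the Selmer-free engine -/

/-- **(U₂ ∧ R′) ⟺ (U₂′ ∧ R″)**, both sides BY NAME where decls exist (`MinimalTwinBSDTwo` 22985, `RankOneNonMinimalResidualAtTwo` 27107): each is
«BSD₂ for every non-CM curve of analytic rank one» cut in two (by `#Sel₂ = 2`, resp. by `W(ℚ)[2] = 0`).  Pure logic. [folklore] -/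
theorem minimalTwin_and_residual_iff_noTwoTorsion_and_torsionCell :
    (MinimalTwinBSDTwo ∧ RankOneNonMinimalResidualAtTwo) ↔
      ((∀ (W : WeierstrassCurve ℚ) [W.IsElliptic] [W.IsGloballyMinimal],
          ¬ W.HasCM → W.analyticRank = 1 → (∀ P : W.toAffine.Point, 2 • P = 0 → P = 0) → BSDp W 2) ∧
        (∀ (W : WeierstrassCurve ℚ) [W.IsElliptic] [W.IsGloballyMinimal],
          ¬ W.HasCM → W.analyticRank = 1 → (¬ ∀ P : W.toAffine.Point, 2 • P = 0 → P = 0) → BSDp W 2)) := by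
  rw [← rankOneBSDTwo_iff_minimalTwin_and_residual]
  constructor
  · intro h
    exact ⟨fun W _ _ hcm hr _ ↦ h W hcm hr, fun W _ _ hcm hr _ ↦ h W hcm hr⟩
  · rintro ⟨hU, hT⟩ W _ _ hcm hr
    by_cases htor : ∀ P : W.toAffine.Point, 2 • P = 0 → P = 0
    · exact hU W hcm hr htor
    · exact hT W hcm hr htor

/-- **Under the re-cut the leaf ⟸ WALL(GK2)×4 + Friedberg–Hoffstein + KEX⁰ + PRINT + the TORSION cell only** — U₂′ is discharged by the landed
Selmer-free engine (`NoTwoTorsion.bsdp_of_wall_of_friedbergHoffstein_of_kex0_of_facts`, p796542), whose WALL input S1′ is the rank-zero consequence of the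
four binders (§1).  CONDITIONAL on the displayed hypotheses (PRINT facts, FH, the four WALL binders, KEX⁰, R″); proves nothing about BSD; closes nothing.
[cite: FriedbergHoffstein1995, main theorem] [cite: GrossZagier1986, V.§2 (2.2)] [cite: Milne1972ArithmeticAV, §1 Thm. 1] -/
theorem nonCMAtTwo_of_wallGK2_of_kex0_of_torsionCell_of_facts
    (hGZ : ∀ (N : ℕ) [NeZero N] (W : WeierstrassCurve ℚ) (K : Type) [Field K] [NumberField K], gross_zagier N W K)
    (hGZK : rank_eq_analyticRank_of_analyticRank_le_one) (hmod : hasEntireLFunction_rat)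
    (hMilneC : Milne1972.bsdQuotient_baseChange_quadratic_anyModel) (hMP : ModularForms.nonempty_modularParametrizationData)
    (hFH : friedbergHoffstein_exists_heegnerField_split_twist_ne_zero)
    (hOrd : WallGoodOrdinaryRankZeroAtTwo) (hMult : WallMultiplicativeRankZeroAtTwo)
    (hSS : WallSupersingularRankZeroAtTwo) (hAdd : WallAdditiveRankZeroAtTwo)
    (hKEX0 : ∀ (W : WeierstrassCurve ℚ) [W.IsElliptic] [W.IsGloballyMinimal] [NeZero (W.conductorNorm ℤ)],
      ¬ W.HasCM → W.analyticRank = 1 → (∀ P : W.toAffine.Point, 2 • P = 0 → P = 0) →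
      ∀ (K : Type) [Field K] [NumberField K], IsImaginaryQuadratic K →
        Odd (NumberField.discr K) → NumberField.discr K ≠ -3 → SatisfiesHeegnerHypothesis (W.conductorNorm ℤ) K →
        ((Ideal.span {(2 : ℤ)}).primesOver (NumberField.RingOfIntegers K)).ncard = 2 →
        ∀ (Wd : WeierstrassCurve ℚ) [Wd.IsElliptic] [Wd.IsGloballyMinimal],
          (∃ C : VariableChange ℚ, C • W.quadraticTwist (NumberField.discr K : ℚ) = Wd) →
        (W.quadraticTwist (NumberField.discr K : ℚ)).entireLFunction 1 ≠ 0 →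
        ∀ (Dt : ModularForms.ModularParametrizationData W (W.conductorNorm ℤ)) (β : ℤ) (ι : K →+* ℂ) (d₁ : KolyvaginHeegnerData Dt β ι 1),
          ∃ M₀ : ℕ,
            (∃ Q : (W.baseChange (ringClassField K ι 1)).toAffine.Point, ((2 ^ M₀ : ℕ) : ℤ) • Q = d₁.derivedPoint) ∧
            (¬ ∃ Q : (W.baseChange (ringClassField K ι 1)).toAffine.Point, ((2 ^ (M₀ + 1) : ℕ) : ℤ) • Q = d₁.derivedPoint) ∧
            Nat.card (AddCommGroup.primaryComponent (W.baseChange K).sha 2) *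
                2 ^ (2 * (padicValInt 2 Dt.c + padicValNat 2 W.tamagawaProduct)) = 2 ^ (2 * M₀))
    (hT : ∀ (W : WeierstrassCurve ℚ) [W.IsElliptic] [W.IsGloballyMinimal],
      ¬ W.HasCM → W.analyticRank = 1 → (¬ ∀ P : W.toAffine.Point, 2 • P = 0 → P = 0) → BSDp W 2) :
    NonCMAtTwo :=
  nonCMAtTwo_of_wallGK2_of_rankOneNoTwoTorsion_of_torsionCell hOrd hMult hSS hAdd
    (bsdp_of_wall_of_friedbergHoffstein_of_kex0_of_facts hGZ hGZK hmod hMilneC hMP hFH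
      (fun W _ _ hcm hr0 ↦ bsdp_rankZero_of_wallGK2 hOrd hMult hSS hAdd W hcm hr0) hKEX0)
    hT

end Summit.BirchSwinnertonDyer.BirchSwinnertonDyer.Theorems.GenusExact.Census.TorsionCell

end
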